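import Literature.NumberTheory.EllipticCurves.BSDAnalyticRankTunnellLeavesProofs
import Literature.NumberTheory.EllipticCurves.CongruentNumberCurveLValueTen
import Literature.NumberTheory.EllipticCurves.BSDAnalyticRankTunnellWaldspurgerLValuesProofs
import HarnessLib

/-!
# Tunnell's Theorem 3 (even twists) from Waldspurger's theorem (as applied on p. 329) alone

Bookkeeping file of the Tunnell cluster (`Literature/NumberTheory/EllipticCurves`), joining
`BSDAnalyticRankTunnellLeavesProofs` (Theorem 3 from Waldspurger's theorem as applied on p. 329
AND the Birch–Swinnerton-Dyer (1965) `L`-values: `Tunnell1983_L_one_even_of_waldspurger_chi2'`)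
with the file that has meanwhile PROVED those `L`-values, `CongruentNumberCurveLValueTen`
(`BirchSwinnertonDyer1965_L_one_two_ten_holds`: `L(E₂, 1) = β/(2√2)`, `L(E₁₀, 1) = 2β/√10`).
It records, as a one-line composition, that the even half of the named fact "Tunnell 1983,
Theorem 3" (`Literature.NumberTheory.EllipticCurves.Tunnell1983_L_one_even` of
`BSDAnalyticRankTunnellProofs`) now rests on exactly ONE named fact — Waldspurger's theorem for
Tunnell's weight-`3/2` forms with character `χ₂ = (2/·)` as applied on p. 329
(`Tunnell1983.Tunnell1983_waldspurger_chi2`, `TunnellHalfIntegralForms`): the continuation of `L(E_n, s)`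
(`hasEntireLFunction_congruentNumberCurve_holds`), the `q`-expansion comparison of p. 329 and the
two CM `L`-values are theorems of the tree. What remains unformalised below the even case of
Theorem 3 is thus precisely the theory of modular forms of half-integral weight as Hecke
eigenforms, the Shimura correspondence, and Waldspurger (1981). (The odd half is analogous, with
`Tunnell1983_waldspurger_triv` and `BirchSwinnertonDyer1965_L_one_one_three_holds` of
`BSDAnalyticRankTunnellWaldspurgerLValuesProofs`.)

**Odd twists (appended).** The odd half is now recorded in the same way: with
`BirchSwinnertonDyer1965_L_one_one_three_holds` (`L(E₁, 1) = β/4`, `L(E₃, 1) = β/√3`,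
`BSDAnalyticRankTunnellWaldspurgerLValuesProofs`) proved,
`Tunnell1983_L_one_odd_of_waldspurger_triv` composes it with
`Tunnell1983_L_one_odd_of_waldspurger_triv'` (`BSDAnalyticRankTunnellLeavesProofs`), so that
`Literature.NumberTheory.EllipticCurves.Tunnell1983_L_one_odd` rests on exactly ONE named
fact, `Tunnell1983.Tunnell1983_waldspurger_triv` (Waldspurger's theorem for `g θ₂, g θ₈`, trivial
character, as applied on p. 329, ll. 7–12); and `Tunnell1983_thm3_of_waldspurger` states the whole
of Theorem 3 behind the two applications of Waldspurger's theorem alone.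

## References

* J. B. Tunnell, *A classical Diophantine problem and modular forms of weight 3/2*, Invent. Math.
  72 (1983) 323–334: Theorem (Waldspurger), p. 328; Thm 3 and its proof, pp. 328–329.
* J.-L. Waldspurger, *Sur les coefficients de Fourier des formes modulaires de poids demi-entier*,
  J. Math. Pures Appl. 60 (1981) 375–484, Thm 1.
* B. J. Birch, H. P. F. Swinnerton-Dyer, *Notes on elliptic curves. II*, J. reine angew. Math. 218
  (1965) 79–108, Table 1.
-/

namespace Literature.NumberTheory.EllipticCurves

open Tunnell1983

/-- **Tunnell 1983, Theorem 3, even twists, from Waldspurger's theorem as applied on p. 329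
(character `χ₂`) alone**: for square-free odd `d`,
`L(E^{2d}, 1) = b(d)² β (2d)^{-1/2}/2` follows from `Tunnell1983_waldspurger_chi2`, the
`L`-values `L(E₂, 1) = β/(2√2)`, `L(E₁₀, 1) = 2β/√10` being proved
(`BirchSwinnertonDyer1965_L_one_two_ten_holds`). [cite: Tunnell1983Congruent, Thm 3, pp. 328–329] -/
theorem Tunnell1983_L_one_even_of_waldspurger_chi2 (hW : Tunnell1983_waldspurger_chi2) :
    Tunnell1983_L_one_even :=
  Tunnell1983_L_one_even_of_waldspurger_chi2' hW BirchSwinnertonDyer1965_L_one_two_ten_holds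

/-- **Tunnell 1983, Theorem 3, odd twists, from Waldspurger's theorem as applied on p. 329
(trivial character) alone**: for square-free odd `d`, `L(Eᵈ, 1) = a(d)² β d^{-1/2}/4` follows
from `Tunnell1983_waldspurger_triv`, the `L`-values `L(E₁, 1) = β/4`, `L(E₃, 1) = β/√3`
(Birch–Swinnerton-Dyer 1965, Table 1, quoted on p. 329) being proved
(`BirchSwinnertonDyer1965_L_one_one_three_holds`), as are the continuation of `L(E_n, s)` and the
`q`-expansion comparison of p. 329 (`Tunnell1983_L_one_odd_of_waldspurger_triv'`).
[cite: Tunnell1983Congruent, Thm 3, pp. 328–329] -/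
theorem Tunnell1983_L_one_odd_of_waldspurger_triv (hW : Tunnell1983_waldspurger_triv) :
    Tunnell1983_L_one_odd :=
  Tunnell1983_L_one_odd_of_waldspurger_triv' hW BirchSwinnertonDyer1965_L_one_one_three_holds

/-- **Tunnell 1983, Theorem 3 (both halves), from the two applications of Waldspurger's theorem
on p. 329 alone** (trivial character for the odd twists, `χ₂` for the even ones).
[cite: Tunnell1983Congruent, Thm 3, pp. 328–329] -/
theorem Tunnell1983_thm3_of_waldspurger (h₁ : Tunnell1983_waldspurger_triv)
    (h₂ : Tunnell1983_waldspurger_chi2) : Tunnell1983_L_one_odd ∧ Tunnell1983_L_one_even :=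
  ⟨Tunnell1983_L_one_odd_of_waldspurger_triv h₁, Tunnell1983_L_one_even_of_waldspurger_chi2 h₂⟩

end Literature.NumberTheory.EllipticCurves
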